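import Literature.NumberTheory.Sieve.Maynard2016Lemma85LamBound
import Literature.NumberTheory.Sieve.FGKMT2018Prop91ErrorTerms
import Literature.NumberTheory.Sieve.Maynard2016Prop61Decomposition
import HarnessLib

/-!
# Maynard 2016, Lemma 8.5 (i) in the Prop. 6.1 frame and Lemma 8.5 (iii) (`w_n ≪ R^{2+o(1)}`, `𝒜 = ℤ`)

Topic `Literature/NumberTheory/Sieve`. Source: J. Maynard, *Dense clusters of primes in subsets*,
Compositio Math. 152 (2016) [Maynard2016DenseClusters], Lemma 8.5 (i), (iii) p. 17; K. Ford, B. Green,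
S. Konyagin, J. Maynard, T. Tao, *Long gaps between primes*, JAMS 31 (2018)
[FordGreenKonyaginMaynardTao2018], Theorem 6, (7.15) p. 22.

We put the Lemma-8.4-free bound `|λ_d| ≤ 2(2e⁵ log R)^k` of
`FGKMT2018.maynard_lamVar_F_abs_le` into the frame of [FGKMT, Thm 6] / [Maynard, Prop. 6.1]
(`FGKMT2018.maynard_lemma85i_frame`: uniformly for `2 ≤ k ≤ (log x)^{1/5}`, coefficients
`|aᵢ| ≤ log x`, `|bᵢ| ≤ x log² x`, `x/2 ≤ X`, `X^{1/30} ≤ R`; the exceptional modulus is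
`E = ∏ᵢ |aᵢ| ∏_{j≠i} |aᵢbⱼ − aⱼbᵢ| ≤ (2x log³x)^{k(k+1)}`, whence the number of its prime factors
`> ⌊R⌋` is `≤ k(k+1) log(2x log³ x)/log⌊R⌋ = o(⌊R⌋/k)`), and deduce the leaf
`Maynard2016DenseClusters_lemma85iiiZ` of `Maynard2016Prop61Decomposition`
(`maynard2016DenseClusters_lemma85iiiZ_holds`): `w_n ≤ (∑_d |λ_d|)² ≤ (λ_max · R(1 + log R)^k)²
≤ X^{2/9+ε}` [Maynard, Lemma 8.5 (iii); FGKMT (7.15)], using `R ≤ X^{1/9}` and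
`(log x)^{O(k)}, C^k = x^{o(1)}` for `k ≤ (log x)^{1/5}`.

## References
* J. Maynard, *Dense clusters of primes in subsets*, Compositio Math. 152 (2016), Lemma 8.5
  [Maynard2016DenseClusters].
* K. Ford, B. Green, S. Konyagin, J. Maynard, T. Tao, *Long gaps between primes*, JAMS 31 (2018),
  Thm 6 (7.15) [FordGreenKonyaginMaynardTao2018].
-/

noncomputable section

open Finset Filter

namespace Literature.NumberTheory.Sieve

namespace FGKMT2018

variable {k : ℕ}

/-! ### The exceptional modulus `E = ∏ᵢ |aᵢ| ∏_{j ≠ i} |aᵢbⱼ − aⱼbᵢ|` -/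

/-- For admissible non-degenerate `𝓛` with `|aᵢ| ≤ M` and `|aᵢbⱼ − aⱼbᵢ| ≤ M` (`M ≥ 1`) there is a
modulus `1 ≤ E ≤ M^{(k+1)k}` (namely `E = ∏ᵢ |aᵢ| ∏_{j≠i} |aᵢbⱼ − aⱼbᵢ|`) such that `ω_𝓛(p) = k` for
every prime `p ∤ E` (the `k` roots `−bᵢ/aᵢ (mod p)` exist and are distinct).
[cite: Maynard2016DenseClusters, Lemma 8.1 proof p. 15 («ω(p) = k for p ∤ ∏ a_i ∏(a_ib_j − a_jb_i)»); FordGreenKonyaginMaynardTao2018, §7 p. 21] -/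
theorem exists_exceptional_modulus {L : Fin k → ℤ × ℤ} (hadm : FormsAdmissible L)
    (hnd : FormsNondegenerate L) {M : ℝ} (hM1 : 1 ≤ M) (ha : ∀ i, |(((L i).1 : ℤ) : ℝ)| ≤ M)
    (hc : ∀ i j, i ≠ j →
      |(((L i).1 : ℤ) : ℝ) * (((L j).2 : ℤ) : ℝ) - (((L j).1 : ℤ) : ℝ) * (((L i).2 : ℤ) : ℝ)| ≤ M) :
    ∃ E : ℕ, 1 ≤ E ∧ (∀ p : ℕ, p.Prime → ¬ p ∣ E → omegaL L p = k) ∧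
      (E : ℝ) ≤ M ^ ((k + 1) * k) := by
  classical
  set c : Fin k → Fin k → ℕ := fun i j =>
    if i = j then 1 else ((L i).1 * (L j).2 - (L j).1 * (L i).2).natAbs with hc'
  set E : ℕ := ∏ i, ((L i).1.natAbs * ∏ j, c i j) with hE
  have hcij : ∀ i j, i ≠ j → c i j = ((L i).1 * (L j).2 - (L j).1 * (L i).2).natAbs := by
    intro i j hij; rw [hc']; dsimp only; rw [if_neg hij]
  have hcii : ∀ i, c i i = 1 := by intro i; rw [hc']; dsimp only; rw [if_pos rfl]
  have hcpos : ∀ i j, 0 < c i j := by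
    intro i j
    by_cases hij : i = j
    · subst hij; rw [hcii]; exact Nat.one_pos
    · rw [hcij i j hij]; exact Int.natAbs_pos.mpr (sub_ne_zero.mpr (hnd i j hij))
  have hfac_pos : ∀ i, 0 < (L i).1.natAbs * ∏ j, c i j := fun i =>
    Nat.mul_pos (Int.natAbs_pos.mpr (hadm.1 i)) (Finset.prod_pos fun j _ => hcpos i j)
  have hEpos : 0 < E := Finset.prod_pos fun i _ => hfac_pos i
  refine ⟨E, hEpos, fun p hp hpE => omegaL_eq_card_of_not_dvd L hp (fun i hdvd => hpE ?_)
    (fun i j hij hdvd => hpE ?_), ?_⟩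
  · have h1 : p ∣ (L i).1.natAbs := by
      have := Int.natAbs_dvd_natAbs.mpr hdvd
      simpa only [Int.natAbs_natCast] using this
    have h2 : (L i).1.natAbs ∣ E := by
      rw [hE]
      exact Dvd.dvd.trans (Dvd.intro _ rfl) (Finset.dvd_prod_of_mem _ (Finset.mem_univ i))
    exact h1.trans h2
  · have h1 : p ∣ ((L i).1 * (L j).2 - (L j).1 * (L i).2).natAbs := by
      have := Int.natAbs_dvd_natAbs.mpr hdvd
      simpa only [Int.natAbs_natCast] using this
    have h2 : ((L i).1 * (L j).2 - (L j).1 * (L i).2).natAbs ∣ E := by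
      rw [hE]
      refine Dvd.dvd.trans ?_ (Finset.dvd_prod_of_mem _ (Finset.mem_univ i))
      refine Dvd.dvd.trans ?_ (Dvd.intro_left _ rfl)
      rw [← hcij i j hij]
      exact Finset.dvd_prod_of_mem (c i) (Finset.mem_univ j)
    exact h1.trans h2
  · have hM0 : 0 ≤ M := zero_le_one.trans hM1
    have hcM : ∀ i j, ((c i j : ℕ) : ℝ) ≤ M := by
      intro i j
      by_cases hij : i = j
      · subst hij; rw [hcii]; simpa using hM1
      · rw [hcij i j hij, Nat.cast_natAbs, Int.cast_abs]; push_cast; exact hc i j hij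
    have haM : ∀ i, (((L i).1.natAbs : ℕ) : ℝ) ≤ M := by
      intro i; rw [Nat.cast_natAbs, Int.cast_abs]; exact ha i
    have hEcast : (E : ℝ) = ∏ i, ((((L i).1.natAbs : ℕ) : ℝ) * ∏ j, ((c i j : ℕ) : ℝ)) := by
      rw [hE, Nat.cast_prod]
      exact Finset.prod_congr rfl fun i _ => by rw [Nat.cast_mul, Nat.cast_prod]
    rw [hEcast]
    calc ∏ i, ((((L i).1.natAbs : ℕ) : ℝ) * ∏ j, ((c i j : ℕ) : ℝ))
        ≤ ∏ _i : Fin k, (M * ∏ _j : Fin k, M) := by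
          refine Finset.prod_le_prod (fun i _ => by positivity) fun i _ => ?_
          exact mul_le_mul (haM i) (Finset.prod_le_prod (fun j _ => by positivity)
            fun j _ => hcM i j) (by positivity) hM0
      _ = M ^ ((k + 1) * k) := by
          rw [Finset.prod_const, Finset.prod_const, Finset.card_univ, Fintype.card_fin, pow_mul,
            pow_succ, mul_comm]

/-- A natural number `E ≥ 1` has at most `log E/log N` prime factors exceeding `N`
(`N^{#} ≤ ∏_{p ∣ E, p > N} p ≤ E`). [cite: Maynard2016DenseClusters, Lemma 8.1 proof p. 15 («at most log Δ/log R prime factors > R»)] -/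
theorem card_primeFactors_filter_mul_log_le {E : ℕ} (hE : E ≠ 0) (N : ℕ) :
    (#(E.primeFactors.filter (fun p => N < p)) : ℝ) * Real.log N ≤ Real.log E := by
  set S := E.primeFactors.filter (fun p => N < p) with hS
  have hprod : ∏ p ∈ S, p ∣ E :=
    (Finset.prod_dvd_prod_of_subset _ _ _ (Finset.filter_subset _ _)).trans
      (Nat.prod_primeFactors_dvd E)
  have hle : N ^ #S ≤ E :=
    (Finset.pow_card_le_prod S (fun p => p) N fun p hp => (Finset.mem_filter.1 hp).2.le).trans
      (Nat.le_of_dvd (Nat.pos_of_ne_zero hE) hprod)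
  have hE1 : (1 : ℝ) ≤ E := by exact_mod_cast Nat.pos_of_ne_zero hE
  rcases Nat.eq_zero_or_pos N with rfl | hN
  · simp only [Nat.cast_zero, Real.log_zero, mul_zero]; exact Real.log_nonneg hE1
  · have hN0 : (0 : ℝ) < N := by exact_mod_cast hN
    have hcast : ((N : ℝ)) ^ #S ≤ (E : ℝ) := by exact_mod_cast hle
    calc (#S : ℝ) * Real.log N = Real.log ((N : ℝ) ^ #S) := (Real.log_pow _ _).symm
      _ ≤ Real.log E := Real.log_le_log (pow_pos hN0 _) hcast

/-! ### Eventual inequalities in the frame (`k ≤ (log x)^{1/5}`, `R ≥ X^{1/30}`, `X ≥ x/2`) -/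

/-- For every `A ≥ 1`, `c`, `ε > 0`: eventually `A^{ck} ≤ x^ε` for all `k ≤ (log x)^{1/5}`.
[cite: FordGreenKonyaginMaynardTao2018, §7 p. 21 (the regime k ≤ (log x)^{1/5}: C^k = x^{o(1)})] -/
theorem eventually_const_pow_le_rpow {A : ℝ} (hA : 1 ≤ A) (c : ℕ) {ε : ℝ} (hε : 0 < ε) :
    ∀ᶠ x : ℕ in atTop, ∀ k : ℕ, (k : ℝ) ≤ Real.log x ^ ((1 : ℝ) / 5) →
      A ^ (c * k) ≤ (x : ℝ) ^ ε := by
  have hT : Tendsto (fun x : ℕ => Real.log x ^ ((4 : ℝ) / 5)) atTop atTop :=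
    (tendsto_rpow_atTop (by norm_num)).comp (Real.tendsto_log_atTop.comp tendsto_natCast_atTop_atTop)
  filter_upwards [hT.eventually_ge_atTop (c * Real.log A / ε), eventually_ge_atTop 3] with x hx hx3 k hk
  have hx3' : (3 : ℝ) ≤ x := by exact_mod_cast hx3
  have hx0 : (0 : ℝ) < x := by linarith
  set ℓ := Real.log (x : ℝ) with hℓ
  have hℓ1 : 1 ≤ ℓ := by
    rw [hℓ, Real.le_log_iff_exp_le (by linarith)]
    exact (Real.exp_one_lt_d9.le.trans (by norm_num)).trans hx3'
  have hℓ0 : 0 ≤ ℓ := zero_le_one.trans hℓ1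
  have hlogA : 0 ≤ Real.log A := Real.log_nonneg hA
  have h45 : ℓ ^ ((1 : ℝ) / 5) * ℓ ^ ((4 : ℝ) / 5) = ℓ := by
    rw [← Real.rpow_add' hℓ0 (by norm_num)]; norm_num
  have hx' : (c : ℝ) * Real.log A ≤ ε * ℓ ^ ((4 : ℝ) / 5) := by
    rw [div_le_iff₀ hε] at hx; linarith
  have hexp : ((c * k : ℕ) : ℝ) * Real.log A ≤ ε * ℓ := by
    push_cast
    calc (c : ℝ) * k * Real.log A ≤ (c : ℝ) * ℓ ^ ((1 : ℝ) / 5) * Real.log A :=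
          mul_le_mul_of_nonneg_right (mul_le_mul_of_nonneg_left hk (Nat.cast_nonneg c)) hlogA
      _ = (c * Real.log A) * ℓ ^ ((1 : ℝ) / 5) := by ring
      _ ≤ ε * ℓ ^ ((4 : ℝ) / 5) * ℓ ^ ((1 : ℝ) / 5) := mul_le_mul_of_nonneg_right hx' (by positivity)
      _ = ε * ℓ := by rw [mul_assoc, mul_comm (ℓ ^ ((4 : ℝ) / 5)), h45]
  have lhs : A ^ (c * k) = Real.exp (((c * k : ℕ) : ℝ) * Real.log A) := by
    rw [← Real.rpow_natCast, Real.rpow_def_of_pos (by linarith), mul_comm]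
  have rhs : (x : ℝ) ^ ε = Real.exp (ε * ℓ) := by
    rw [Real.rpow_def_of_pos hx0, mul_comm]
  rw [lhs, rhs]
  exact Real.exp_le_exp.2 hexp

/-- The frame inequalities for Lemma 8.5 (i): eventually in `x`, for all `k ≤ (log x)^{1/5}`,
`X ≥ x/2`, `R ≥ X^{1/30}`: `⌊R⌋ ≥ 2`, `⌊R⌋ ≥ 2k²` and `4k³ log(x⁵) ≤ ⌊R⌋ log⌊R⌋`
(all from `⌊R⌋ ≥ x^{1/30}/4` and `(log x)^{8/5} = o(x^{1/30})`).
[cite: FordGreenKonyaginMaynardTao2018, Thm 6 p. 21 (the regime k ≤ (log x)^{1/5}, x/2 ≤ X, X^{1/30} ≤ R)] -/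
theorem eventually_lemma85_aux :
    ∀ᶠ x : ℕ in atTop, ∀ k : ℕ, (k : ℝ) ≤ Real.log x ^ ((1 : ℝ) / 5) → ∀ X R : ℝ,
      (x : ℝ) / 2 ≤ X → X ^ ((1 : ℝ) / 30) ≤ R →
        2 ≤ ⌊R⌋₊ ∧ 2 * k ^ 2 ≤ ⌊R⌋₊ ∧
          (4 : ℝ) * k ^ 3 * (5 * Real.log x) ≤ ⌊R⌋₊ * Real.log ⌊R⌋₊ := by
  have hP : Tendsto (fun x : ℕ => (x : ℝ) ^ ((1 : ℝ) / 30)) atTop atTop :=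
    (tendsto_rpow_atTop (by norm_num)).comp tendsto_natCast_atTop_atTop
  have ho := isLittleO_log_rpow_rpow_atTop ((8 : ℝ) / 5) (by norm_num : (0 : ℝ) < 1 / 30)
  have ho2 := isLittleO_log_rpow_rpow_atTop ((2 : ℝ) / 5) (by norm_num : (0 : ℝ) < 1 / 30)
  filter_upwards [hP.eventually_ge_atTop 8, eventually_ge_atTop 3,
    tendsto_natCast_atTop_atTop.eventually (ho.bound (by norm_num : (0 : ℝ) < 1 / 160)),
    tendsto_natCast_atTop_atTop.eventually (ho2.bound (by norm_num : (0 : ℝ) < 1 / 8))]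
    with x hx8 hx3 h85 h25 k hk X R hX hR
  have hx3' : (3 : ℝ) ≤ x := by exact_mod_cast hx3
  have hx0 : (0 : ℝ) < x := by linarith
  set ℓ := Real.log (x : ℝ) with hℓ
  have hℓ1 : 1 ≤ ℓ := by
    rw [hℓ, Real.le_log_iff_exp_le (by linarith)]
    exact (Real.exp_one_lt_d9.le.trans (by norm_num)).trans hx3'
  have hℓ0 : 0 ≤ ℓ := zero_le_one.trans hℓ1
  set P := (x : ℝ) ^ ((1 : ℝ) / 30) with hPdef
  have hP0 : 0 ≤ P := Real.rpow_nonneg hx0.le _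
  -- strip the norms
  rw [Real.norm_of_nonneg (Real.rpow_nonneg hℓ0 _), Real.norm_of_nonneg hP0] at h85 h25
  -- `⌊R⌋ ≥ P/4`
  have hR' : P / 2 ≤ R := by
    have h1 : ((x : ℝ) / 2) ^ ((1 : ℝ) / 30) ≤ R :=
      (Real.rpow_le_rpow (by positivity) hX (by norm_num)).trans hR
    have h2 : ((x : ℝ) / 2) ^ ((1 : ℝ) / 30) = P / (2 : ℝ) ^ ((1 : ℝ) / 30) := by
      rw [hPdef, Real.div_rpow hx0.le (by norm_num)]
    have h3 : (2 : ℝ) ^ ((1 : ℝ) / 30) ≤ 2 := by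
      conv_rhs => rw [← Real.rpow_one 2]
      exact Real.rpow_le_rpow_of_exponent_le (by norm_num) (by norm_num)
    have h4 : P / 2 ≤ P / (2 : ℝ) ^ ((1 : ℝ) / 30) :=
      div_le_div_of_nonneg_left hP0 (by positivity) h3
    linarith
  set N := ⌊R⌋₊ with hN
  have hNR : R < (N : ℝ) + 1 := Nat.lt_floor_add_one R
  have hNP : P / 4 ≤ (N : ℝ) := by linarith
  have hN2r : (2 : ℝ) ≤ N := by linarith
  have hN2 : 2 ≤ N := by exact_mod_cast hN2r
  -- `k² ≤ ℓ^{2/5}`, `k³ ≤ ℓ^{3/5}`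
  have hk0 : (0 : ℝ) ≤ k := Nat.cast_nonneg k
  have hk2 : (k : ℝ) ^ 2 ≤ ℓ ^ ((2 : ℝ) / 5) := by
    have h := pow_le_pow_left₀ hk0 hk 2
    rw [← Real.rpow_natCast (ℓ ^ ((1 : ℝ) / 5)) 2, ← Real.rpow_mul hℓ0] at h
    norm_num at h
    exact h
  have hk3 : (k : ℝ) ^ 3 ≤ ℓ ^ ((3 : ℝ) / 5) := by
    have h := pow_le_pow_left₀ hk0 hk 3
    rw [← Real.rpow_natCast (ℓ ^ ((1 : ℝ) / 5)) 3, ← Real.rpow_mul hℓ0] at h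
    norm_num at h
    exact h
  have h85' : ℓ ^ ((3 : ℝ) / 5) * ℓ = ℓ ^ ((8 : ℝ) / 5) := by
    rw [← Real.rpow_add_one (by linarith)]; norm_num
  refine ⟨hN2, ?_, ?_⟩
  · have : (2 : ℝ) * (k : ℝ) ^ 2 ≤ N := by linarith
    exact_mod_cast this
  · have hlogN : Real.log 2 ≤ Real.log N := Real.log_le_log (by norm_num) hN2r
    have hl2 : (1 : ℝ) / 2 ≤ Real.log 2 := by linarith [Real.log_two_gt_d9]
    have hNlog : (N : ℝ) * (1 / 2) ≤ N * Real.log N :=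
      mul_le_mul_of_nonneg_left (hl2.trans hlogN) (by linarith)
    calc (4 : ℝ) * k ^ 3 * (5 * ℓ) = 20 * ((k : ℝ) ^ 3 * ℓ) := by ring
      _ ≤ 20 * (ℓ ^ ((3 : ℝ) / 5) * ℓ) :=
          mul_le_mul_of_nonneg_left (mul_le_mul_of_nonneg_right hk3 hℓ0) (by norm_num)
      _ = 20 * ℓ ^ ((8 : ℝ) / 5) := by rw [h85']
      _ ≤ 20 * (1 / 160 * P) := mul_le_mul_of_nonneg_left h85 (by norm_num)
      _ = (P / 4) * (1 / 2) := by ring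
      _ ≤ N * (1 / 2) := mul_le_mul_of_nonneg_right hNP (by norm_num)
      _ ≤ N * Real.log N := hNlog

/-- **Maynard 2016, Lemma 8.5 (i) in the frame of Prop. 6.1 / [FGKMT, Thm 6]** (crude form):
for all large `x`, uniformly for `B = 1` or prime, `2 ≤ k ≤ (log x)^{1/5}`, admissible non-degenerate
`𝓛 = {aᵢn + bᵢ}` with `|aᵢ| ≤ log x`, `|bᵢ| ≤ x log²x`, `x/2 ≤ X ≤ x log²x`, `X^{1/30} ≤ R ≤ X^{1/9}`,
the weights (7.9) built from `F = F_k` satisfy `|λ_d| ≤ 2(2e⁵ log R)^k` for every `d`.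
(Exceptional modulus `E ≤ (2x log³x)^{k(k+1)} ≤ x^{5k(k+1)}`, so `#{p ∣ E : p > ⌊R⌋} ≤ 10k² log x/log⌊R⌋`,
and `2k · (that) ≤ ⌊R⌋ + 1` by `eventually_lemma85_aux`.)
[cite: Maynard2016DenseClusters, Lemma 8.5 (i) p. 17; FordGreenKonyaginMaynardTao2018, Thm 6 p. 21–22] -/
theorem maynard_lemma85i_frame :
    Prop61Frame 2 fun B k L _X R =>
      ∀ d : Fin k → ℕ, |lamVar L B R (MaynardDense.F k) d| ≤ 2 * (2 * Real.exp 5 * Real.log R) ^ k := by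
  unfold Prop61Frame
  filter_upwards [eventually_lemma85_aux, eventually_ge_atTop 3] with x hx hx3 B hB hBx k L X R hCk hk
    hadm hnd hcoef hX1 hX2 hR1 hR2 d
  obtain ⟨hN2, hkN, hmain⟩ := hx k hk X R hX1 hR1
  have hx3' : (3 : ℝ) ≤ x := by exact_mod_cast hx3
  have hx0 : (0 : ℝ) < x := by linarith
  set ℓ := Real.log (x : ℝ) with hℓ
  have hℓ1 : 1 ≤ ℓ := by
    rw [hℓ, Real.le_log_iff_exp_le (by linarith)]
    exact (Real.exp_one_lt_d9.le.trans (by norm_num)).trans hx3'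
  have hℓ0 : 0 ≤ ℓ := zero_le_one.trans hℓ1
  have hℓx : ℓ ≤ x := Real.log_le_self hx0.le
  -- the exceptional modulus with `M = 2x log³x`
  set M := 2 * (x : ℝ) * ℓ ^ 3 with hM
  have hM1 : 1 ≤ M := by
    have : (1 : ℝ) ≤ ℓ ^ 3 := one_le_pow₀ hℓ1
    rw [hM]; nlinarith
  have haM : ∀ i, |(((L i).1 : ℤ) : ℝ)| ≤ M := by
    intro i
    refine (hcoef i).1.trans ?_
    have : ℓ ^ 3 = ℓ * ℓ ^ 2 := by ring
    have h2 : (1 : ℝ) ≤ ℓ ^ 2 := one_le_pow₀ hℓ1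
    rw [hM]; nlinarith
  have hcM : ∀ i j, i ≠ j →
      |(((L i).1 : ℤ) : ℝ) * (((L j).2 : ℤ) : ℝ) - (((L j).1 : ℤ) : ℝ) * (((L i).2 : ℤ) : ℝ)| ≤ M := by
    intro i j _
    have h1 := abs_sub (((((L i).1 : ℤ) : ℝ)) * (((L j).2 : ℤ) : ℝ))
      ((((L j).1 : ℤ) : ℝ) * (((L i).2 : ℤ) : ℝ))
    rw [abs_mul, abs_mul] at h1
    have hi := hcoef i
    have hj := hcoef j
    have hb0 : (0 : ℝ) ≤ x * ℓ ^ 2 := by positivity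
    have e1 : |(((L i).1 : ℤ) : ℝ)| * |(((L j).2 : ℤ) : ℝ)| ≤ ℓ * (x * ℓ ^ 2) :=
      mul_le_mul hi.1 hj.2 (abs_nonneg _) hℓ0
    have e2 : |(((L j).1 : ℤ) : ℝ)| * |(((L i).2 : ℤ) : ℝ)| ≤ ℓ * (x * ℓ ^ 2) :=
      mul_le_mul hj.1 hi.2 (abs_nonneg _) hℓ0
    calc _ ≤ ℓ * (x * ℓ ^ 2) + ℓ * (x * ℓ ^ 2) := h1.trans (add_le_add e1 e2)
      _ = M := by rw [hM]; ring
  obtain ⟨E, hE1, hE, hEle⟩ := exists_exceptional_modulus hadm hnd hM1 haM hcM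
  refine maynard_lamVar_F_abs_le hCk hadm hnd hB hN2 hkN hE1 hE ?_ d
  -- few prime factors of `E` beyond `N = ⌊R⌋`
  set N := ⌊R⌋₊ with hN
  set b := #(E.primeFactors.filter (fun p => N < p)) with hb
  have hE0 : E ≠ 0 := by omega
  have hN2r : (2 : ℝ) ≤ N := by exact_mod_cast hN2
  have hlogN : 0 < Real.log N := Real.log_pos (by linarith)
  have hMx : M ≤ (x : ℝ) ^ 5 := by
    have h2x : 2 * (x : ℝ) ≤ x ^ 2 := by nlinarith
    have hl3 : ℓ ^ 3 ≤ (x : ℝ) ^ 3 := pow_le_pow_left₀ hℓ0 hℓx 3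
    calc M = 2 * (x : ℝ) * ℓ ^ 3 := hM
      _ ≤ (x : ℝ) ^ 2 * (x : ℝ) ^ 3 := mul_le_mul h2x hl3 (by positivity) (by positivity)
      _ = (x : ℝ) ^ 5 := by ring
  have hlogM : Real.log M ≤ 5 * ℓ := by
    calc Real.log M ≤ Real.log ((x : ℝ) ^ 5) := Real.log_le_log (by linarith) hMx
      _ = 5 * ℓ := by rw [Real.log_pow, hℓ]; norm_num
  have hlogE : Real.log E ≤ ((k + 1) * k : ℕ) * (5 * ℓ) := by
    have hE1r : (0 : ℝ) < E := by exact_mod_cast hE1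
    calc Real.log E ≤ Real.log (M ^ ((k + 1) * k)) := Real.log_le_log hE1r hEle
      _ = ((k + 1) * k : ℕ) * Real.log M := by rw [Real.log_pow]
      _ ≤ ((k + 1) * k : ℕ) * (5 * ℓ) := mul_le_mul_of_nonneg_left hlogM (Nat.cast_nonneg _)
  have hk1 : 1 ≤ k := by omega
  have hbnd : (b : ℝ) * Real.log N ≤ ((k + 1) * k : ℕ) * (5 * ℓ) :=
    (card_primeFactors_filter_mul_log_le hE0 N).trans hlogE
  have hreal : (2 * k * b : ℕ) * Real.log N ≤ N * Real.log N := by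
    have hkk : (((k + 1) * k : ℕ) : ℝ) ≤ 2 * (k : ℝ) ^ 2 := by
      have : (k + 1) * k ≤ 2 * k ^ 2 := by nlinarith
      exact_mod_cast this
    calc ((2 * k * b : ℕ) : ℝ) * Real.log N = 2 * k * ((b : ℝ) * Real.log N) := by push_cast; ring
      _ ≤ 2 * k * (((k + 1) * k : ℕ) * (5 * ℓ)) := mul_le_mul_of_nonneg_left hbnd (by positivity)
      _ ≤ 2 * k * (2 * (k : ℝ) ^ 2 * (5 * ℓ)) :=
          mul_le_mul_of_nonneg_left (mul_le_mul_of_nonneg_right hkk (by positivity)) (by positivity)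
      _ = 4 * (k : ℝ) ^ 3 * (5 * ℓ) := by ring
      _ ≤ N * Real.log N := hmain
  have : (2 * k * b : ℕ) ≤ N := by exact_mod_cast le_of_mul_le_mul_right hreal hlogN
  omega

end FGKMT2018

/-! ### Lemma 8.5 (iii): `w_n ≪ R² λ_max² (log R)^{2k} ≤ X^{2/9+ε}` -/

open FGKMT2018 in
/-- **Maynard 2016, Lemma 8.5 (iii) for `𝒜 = ℤ`** ([FGKMT, Thm 6 (7.15)]): the leaf
`Maynard2016DenseClusters_lemma85iiiZ` holds (threshold `C = 2`): for every `ε > 0`, in the frame,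
`0 ≤ w_n ≤ (∑_{d ∈ 𝒟_k} |λ_d|)² ≤ (λ_max · R(1 + log R)^k)² ≤ (2(2e⁵ log R)^k)² R² (1 + log R)^{2k}
≤ X^{2/9+ε}`, by Lemma 8.5 (i) (`maynard_lemma85i_frame`), the support bound
`#{d : ∏dᵢ < R} ≤ R(1 + log R)^k` (`sum_abs_lamVar_F_le`), `R ≤ X^{1/9}` and
`C^k, (log x)^{O(k)} = x^{o(1)}` for `k ≤ (log x)^{1/5}`.
[cite: Maynard2016DenseClusters, Lemma 8.5 (iii) p. 17; FordGreenKonyaginMaynardTao2018, Thm 6 (7.15) p. 22] -/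
theorem maynard2016DenseClusters_lemma85iiiZ_holds : Maynard2016DenseClusters_lemma85iiiZ := by
  refine ⟨2, fun ε hε => ?_⟩
  have hF := maynard_lemma85i_frame
  have hε4 : 0 < ε / 4 := by linarith
  have hA : (1 : ℝ) ≤ 1296 * Real.exp 5 ^ 2 := by
    have := Real.one_lt_exp_iff.2 (by norm_num : (0 : ℝ) < 5)
    nlinarith
  unfold Prop61Frame at hF ⊢
  filter_upwards [hF, eventually_one_add_log_pow_le_rpow 4 hε4, eventually_const_pow_le_rpow hA 1 hε4,
    eventually_ge_atTop 4] with x hlam hlog hconst hx4 B hB hBx k L X R hCk hk hadm hnd hcoef hX1 hX2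
    hR1 hR2 n
  have hΛ := hlam B hB hBx k L X R hCk hk hadm hnd hcoef hX1 hX2 hR1 hR2
  have hlogk := hlog k hk
  have hconstk := hconst k hk
  rw [one_mul] at hconstk
  have hx4' : (4 : ℝ) ≤ x := by exact_mod_cast hx4
  have hx0 : (0 : ℝ) < x := by linarith
  set ℓ := Real.log (x : ℝ) with hℓ
  have hℓ1 : 1 ≤ ℓ := by
    rw [hℓ, Real.le_log_iff_exp_le (by linarith)]
    have h3 : Real.exp 1 ≤ 3 := Real.exp_one_lt_d9.le.trans (by norm_num)
    linarith
  have hℓ0 : 0 ≤ ℓ := zero_le_one.trans hℓ1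
  have hℓx : ℓ ≤ x := Real.log_le_self hx0.le
  -- sizes of `X` and `R`
  have hX2' : (2 : ℝ) ≤ X := by linarith
  have hX0 : 0 < X := by linarith
  have hX1' : (1 : ℝ) ≤ X := by linarith
  have hR1' : (1 : ℝ) < R := by
    have : (1 : ℝ) < X ^ ((1 : ℝ) / 30) := Real.one_lt_rpow (by linarith) (by norm_num)
    linarith
  have hRX : R ≤ X := hR2.trans (by
    conv_rhs => rw [← Real.rpow_one X]
    exact Real.rpow_le_rpow_of_exponent_le hX1' (by norm_num))
  have hRx3 : R ≤ (x : ℝ) ^ 3 := by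
    refine hRX.trans (hX2.trans ?_)
    have : ℓ ^ 2 ≤ (x : ℝ) ^ 2 := pow_le_pow_left₀ hℓ0 hℓx 2
    calc (x : ℝ) * ℓ ^ 2 ≤ x * (x : ℝ) ^ 2 := mul_le_mul_of_nonneg_left this hx0.le
      _ = (x : ℝ) ^ 3 := by ring
  have hlogR0 : 0 ≤ Real.log R := Real.log_nonneg hR1'.le
  have hlogR : Real.log R ≤ 3 * ℓ := by
    calc Real.log R ≤ Real.log ((x : ℝ) ^ 3) := Real.log_le_log (by linarith) hRx3
      _ = 3 * ℓ := by rw [Real.log_pow, hℓ]; norm_num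
  set a := 1 + ℓ with ha
  have ha1 : 1 ≤ a := by linarith
  have h1R : 1 + Real.log R ≤ 3 * a := by linarith
  have hlR : Real.log R ≤ 3 * a := by linarith
  -- `w_n ≤ (∑ |λ_d|)²`
  set Λ := 2 * (2 * Real.exp 5 * Real.log R) ^ k with hΛdef
  have hΛ0 : 0 ≤ Λ := by positivity
  set S := ∑ d ∈ dkBox L B R, |lamVar L B R (MaynardDense.F k) d| with hS
  have hS0 : 0 ≤ S := Finset.sum_nonneg fun _ _ => abs_nonneg _
  have hSle : S ≤ Λ * (R * (1 + Real.log R) ^ k) :=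
    sum_abs_lamVar_F_le L B hR1' hΛ0 fun d _ => hΛ d
  have hw : sieveWt L B R (MaynardDense.F k) n ≤ S ^ 2 := by
    unfold sieveWt
    split_ifs with hcop
    · rw [← sq_abs]
      refine pow_le_pow_left₀ (abs_nonneg _) ?_ 2
      exact (Finset.abs_sum_le_sum_abs _ _).trans
        (Finset.sum_le_sum_of_subset_of_nonneg (Finset.filter_subset _ _) fun _ _ _ => abs_nonneg _)
    · positivity
  -- the bound for `Λ · R(1 + log R)^k`
  have hT : Λ * (R * (1 + Real.log R) ^ k) ≤ 2 * ((18 * Real.exp 5) * a ^ 2) ^ k * R := by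
    have h1 : (2 * Real.exp 5 * Real.log R) ^ k ≤ (2 * Real.exp 5 * (3 * a)) ^ k :=
      pow_le_pow_left₀ (by positivity) (mul_le_mul_of_nonneg_left hlR (by positivity)) k
    have h2 : (1 + Real.log R) ^ k ≤ (3 * a) ^ k :=
      pow_le_pow_left₀ (by linarith) h1R k
    have h3 : (2 * Real.exp 5 * (3 * a)) * (3 * a) = (18 * Real.exp 5) * a ^ 2 := by ring
    calc Λ * (R * (1 + Real.log R) ^ k)
        ≤ 2 * (2 * Real.exp 5 * (3 * a)) ^ k * (R * (3 * a) ^ k) := by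
          refine mul_le_mul (mul_le_mul_of_nonneg_left h1 (by norm_num))
            (mul_le_mul_of_nonneg_left h2 (by linarith)) (by positivity) (by positivity)
      _ = 2 * ((2 * Real.exp 5 * (3 * a)) * (3 * a)) ^ k * R := by
          rw [mul_pow (2 * Real.exp 5 * (3 * a)) (3 * a) k]; ring
      _ = 2 * ((18 * Real.exp 5) * a ^ 2) ^ k * R := by rw [h3]
  -- squares and the `x^{o(1)}` bounds
  have hR2' : R ^ 2 ≤ X ^ ((2 : ℝ) / 9) := by
    have h := pow_le_pow_left₀ (by linarith : (0 : ℝ) ≤ R) hR2 2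
    rw [← Real.rpow_natCast (X ^ ((1 : ℝ) / 9)) 2, ← Real.rpow_mul hX0.le] at h
    norm_num at h
    exact h
  have hconst' : (2 * (18 * Real.exp 5) ^ k) ^ 2 ≤ (x : ℝ) ^ (ε / 4) := by
    have hk1 : k ≠ 0 := by omega
    have h4 : (4 : ℝ) ≤ 4 ^ k := by
      calc (4 : ℝ) = 4 ^ 1 := (pow_one _).symm
        _ ≤ 4 ^ k := pow_le_pow_right₀ (by norm_num) (Nat.one_le_iff_ne_zero.2 hk1)
    calc (2 * (18 * Real.exp 5) ^ k) ^ 2 = 4 * ((18 * Real.exp 5) ^ 2) ^ k := by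
          rw [mul_pow, ← pow_mul, mul_comm k 2, pow_mul]; norm_num
      _ ≤ 4 ^ k * ((18 * Real.exp 5) ^ 2) ^ k := mul_le_mul_of_nonneg_right h4 (by positivity)
      _ = (4 * (18 * Real.exp 5) ^ 2) ^ k := by rw [← mul_pow]
      _ = (1296 * Real.exp 5 ^ 2) ^ k := by congr 1; ring
      _ ≤ (x : ℝ) ^ (ε / 4) := hconstk
  have hapow : ((a ^ 2) ^ k) ^ 2 ≤ (x : ℝ) ^ (ε / 4) := by
    rw [← pow_mul, ← pow_mul, show 2 * (k * 2) = 4 * k by ring]; exact hlogk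
  have hxX : (x : ℝ) ^ (ε / 4) * (x : ℝ) ^ (ε / 4) ≤ X ^ ε := by
    rw [← Real.rpow_add hx0, show ε / 4 + ε / 4 = (1 / 2 : ℝ) * ε by ring, Real.rpow_mul hx0.le]
    refine Real.rpow_le_rpow (by positivity) ?_ hε.le
    -- `x^{1/2} ≤ x/2 ≤ X` for `x ≥ 4`
    have hs : (x : ℝ) ^ ((1 : ℝ) / 2) * (x : ℝ) ^ ((1 : ℝ) / 2) = x := by
      rw [← Real.rpow_add hx0]; norm_num
    have h2 : (2 : ℝ) ≤ (x : ℝ) ^ ((1 : ℝ) / 2) := by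
      have h := Real.rpow_le_rpow (by norm_num) hx4' (by norm_num : (0 : ℝ) ≤ 1 / 2)
      rwa [show (4 : ℝ) = 2 ^ (2 : ℝ) by norm_num, ← Real.rpow_mul (by norm_num),
        show (2 : ℝ) * (1 / 2) = 1 by norm_num, Real.rpow_one] at h
    nlinarith [Real.rpow_nonneg hx0.le ((1 : ℝ) / 2)]
  calc sieveWt L B R (MaynardDense.F k) n ≤ S ^ 2 := hw
    _ ≤ (2 * ((18 * Real.exp 5) * a ^ 2) ^ k * R) ^ 2 :=
        pow_le_pow_left₀ hS0 (hSle.trans hT) 2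
    _ = (2 * (18 * Real.exp 5) ^ k) ^ 2 * ((a ^ 2) ^ k) ^ 2 * R ^ 2 := by rw [mul_pow]; ring
    _ ≤ (x : ℝ) ^ (ε / 4) * (x : ℝ) ^ (ε / 4) * X ^ ((2 : ℝ) / 9) := by
        refine mul_le_mul (mul_le_mul hconst' hapow (by positivity) (by positivity)) hR2'
          (by positivity) (by positivity)
    _ ≤ X ^ ε * X ^ ((2 : ℝ) / 9) := mul_le_mul_of_nonneg_right hxX (by positivity)
    _ = X ^ ((2 : ℝ) / 9 + ε) := by rw [mul_comm, ← Real.rpow_add hX0]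

/-- **`Maynard2016DenseClusters_lemma85iiiZ` holds** (Maynard 2016, Lemma 8.5 (iii) for `𝒜 = ℤ`:
`w_n ≪ X^{2/9+ε}`, threshold `C = 2`) — the exact-name `_holds` alias of
`maynard2016DenseClusters_lemma85iiiZ_holds` above (appended 2026-08-29, flt-inv gen 69; D-0026
bookkeeping: the proof term is the existing theorem of this file; no statement, definition or attribute
is edited; no new named fact; the ledger's debt table listed the fact unproved at +61 min,
`ledger fact claim` GRANTED 2026-08-29T09:09Z).
[cite: Maynard2016DenseClusters, Lemma 8.5 (iii) p. 17; FordGreenKonyaginMaynardTao2018, Thm 6 (7.15) p. 22] -/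
theorem Maynard2016DenseClusters_lemma85iiiZ_holds :
    _root_.Literature.NumberTheory.Sieve.Maynard2016DenseClusters_lemma85iiiZ :=
  _root_.Literature.NumberTheory.Sieve.maynard2016DenseClusters_lemma85iiiZ_holds

end Literature.NumberTheory.Sieve
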